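import Summits.QuantumFields.YangMills.Theorems.BalabanUVNodesK0S5CollarMeetFamily
import Literature.MathematicalPhysics.QuantumFieldTheory.Balaban1983to89.Node00.TorusCoverCollarOfMeetsPrintBox
import Literature.MathematicalPhysics.QuantumFieldTheory.Balaban1983to89.Node00.TorusCoverCubeDomains
import Literature.MathematicalPhysics.QuantumFieldTheory.Balaban1983to89.Node00.DomainsMeet
import Literature.MathematicalPhysics.QuantumFieldTheory.Balaban1983to89.Node00.DomainsOfSeq
import HarnessLib

/-!
# N07 [B11] (= [15] = [Balaban1985Variational]) Sect. F — **THE CUBE TOWER OF A MEETING DATUM SITS INSIDE THE RECORD BELOW THE TOP**: for a separated sequence (`M₁ ≥ 11d + 4ρ + M + 3`)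
# and a level-`n` datum whose print box meets `Ω_n`, every cube `□_i`, `1 ≤ i < n`, of the (1.131) tower projects into `Ω_i`; hence print's (150) family `Ω′_i = □_i ∩ Ω_i` IS `□_i`
# strictly below the top — the levelwise meet `cubeDomains ⊓ domainsOfSeq Ω` CONTAINS the cube tower there (k0-s1-w3's `hbelow`) — and the near class of HCHART-MEET-NORM-77
# («top, or both end blocks in the next cube») is «top cells ∪ level-(n−1) DENT PAIRS under `□_n ∖ Ω_n`» = exactly the cells MODULE 75 serves

Cell `pub-ymgap`, seat `pub-ymgap-dag-n07-e` g26 (FAN-OUT §N07 row s3; LANE OWNER of the K0 road), MODULE 79 (INTENT-79, cell bus).  `--kind proof --supports stmt-QuantumFields-20541 --as helper`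
(K0⁷); count-neutral; def-free.  [15] = [Balaban1985Variational]; [6] = [Balaban1985RegularSpaces]; [III] = [Balaban1988Convergent]; [4] = [Balaban1984PropagatorsII].

WHY.  Print (150) p. 301: «`Ω′_j = □_j`, `j = 0, 1, …, k − 1`, `Ω′_k = □″_k = □_k ∩ Ω_k`» — print's local family meets the record's regions at the TOP only.  The tree's family of record is the
LEVELWISE meet `D″ = cubeDomains ⊓ domainsOfSeq Ω` (n07-e INTENT-44, n07-w4 FILE C, k0-s1-w3 `K0S5MeetFamilyJunction`), which agrees with print's iff `□_i ⊆ Ω_i` (blockwise) for `1 ≤ i < k`.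
At a MEETING datum of a SEPARATED sequence this holds with room to spare: the print box has a point within `3` of a lift of a site of `Ω_n`, [6] (1.3)–(1.6) ∕ [III] (2.13) separation
`Ω_{n−1} ⊇ Ω_n + M₁Lⁿ` (`Sect2.SeqSeparated M₁ s`), and every `□_i`, `i ≤ n`, lies in print's window `□̃` = the box widened by `2ρ` blocks ([6] p. 98), so `□_i ⊆ Ω_{n−1} ⊆ Ω_i` once
`11d + 2ρ + M + 3 + 2ρ ≤ M₁` (n07-w4 ∕ n07-e 57a's collar `Sect2.cover_mem_Ω_pred_of_near_box_propCubeP_box` at margin `E = 2ρ`).  Consequences: k0-s1-w3's `K0S5CollarMeetFamily.near_cases`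
premise `hbelow` holds for `D″`, so a cell of `D″` below the top with a block in the next cube is at level `n − 1` (print's `□′_n^{(n−1)}`), and with MODULE 77's near class «BOTH end blocks
in the next cube» the near cells below the top are the level-(n−1) cells with both end blocks in `□_n^{(n)} ∖ Ω_n^{(n)}` — the DENT PAIRS of MODULE 75 (`…N07NearRowsAtRecordWide`).

WHAT IS PROVED (sorry-free; no definition; axioms standard; `P : Params` generic, any separated `s : Seq D k`).
§1 `Ω_anti_of_seq` (a separated∕chained sequence decreases: `Ω_j ⊆ Ω_i` for `1 ≤ i ≤ j ≤ k`), ★★ `cover_mem_Ω_of_mem_cube_of_meet` (the header's inclusion: `z ∈ □_i`, `1 ≤ i < n` ⇒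
   `π z ∈ Ω_i`).
§2 ★★ `cubeDomains_Om_subset_meet_Om` (`hbelow` for the meet: `(cubeDomains …).Om i ⊆ (cubeDomains ⊓ domainsOfSeq Ω n).Om i`, `1 ≤ i < n`), ★ `meet_Om_eq_cubeDomains_Om` (equality there).
§3 ★★★ `near_cases_meet_both` — every cell of `D″`: TOP level, or a level-(n−1) DENT PAIR (`j(c) + 1 = n`, both end blocks in `□_{j(c)+1}^{(j(c)+1)}` and NOT in `(domainsOfSeq Ω n).Om (j(c)+1)`),
   or outside MODULE 77's near class (hence `ρ`-far, 77a `hcollar_of_not_nearBoth`).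
HONEST SCOPE.  Lattice∕torus bookkeeping on displayed hypotheses (separation, the meeting premise, the floor); nothing of [15]∕[6]∕[III]∕[4] ANALYSIS asserted; the dispatch of MODULE 75's
rows onto the dent pairs (label form `castSite t`, `t ± e_μ`, non-wrapping) is NOT done here; K0⁷ ∕ K1⁹ NOT closed; N07 NOT discharged; counts unmoved (typed 28∕28 · discharged 8∕27 per
the chair); one finite 𝕋⁴ programme at fixed ε — the route closes the conditional finite-𝕋⁴ rung `BalabanLadder.UV` ONLY; the YM mass gap (Clay) is NOT proved by any of this; nothing
continuum ∕ ℝ⁴ ∕ OS.  No `sorry`, no `def`, no `instance`, no `notation`.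

References: [15] (144) p. 300, (147)–(150) p. 301, (160) p. 303; [6] (1.3)–(1.6) p. 77, p. 98, (1.131) p. 99; [III] (2.1)–(2.2) p. 254, (2.13) p. 256; [4] (2.1)–(2.3) p. 224.
-/

set_option autoImplicit false

noncomputable section

namespace Summit.QuantumFields.YangMills.BalabanUVNodes.N07CubeTowerInsideRecordBelowTop

open Literature.MathematicalPhysics.QuantumFieldTheory.Balaban1983to89
open Literature.MathematicalPhysics.QuantumFieldTheory.Balaban1983to89.Node00
open B15Eq112TorusCover (cover)
open B14DomainGeom (Pt Within)
open B14.Eq218Concrete (Seq)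
open B5Eq118OneStroke (iterBlockOf iterBlock mem_iterBlock)
open B7Prop1Local (InBox)
open B8Eq131Cubes (box cube tcube sqLo sqHi cube_anti cube_subset_tcube)
open B6SectADomainsV1 (Domains)
open B6SectAOperatorsV1 (BondIdx)
open Literature.MathematicalPhysics.QuantumLattice (blockMap blockSites mem_blockSites_iff)
open Summit.QuantumFields.YangMills.Theorems.K0S5CollarMeetFamily (level_succ_eq_of_near_below)

variable {P : Params}

/-! ## §1  Every cube of the tower below the top projects into the record's region of its level -/

/-- A chained sequence decreases: `Ω_j ⊆ Ω_i` for `1 ≤ i ≤ j ≤ k`. [cite: Balaban1988Convergent, (2.1)–(2.2) p.254] -/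
theorem Ω_anti_of_seq {α : Type*} {D : ℕ → Set (Set α)} {k : ℕ} (s : Seq D k) {i j : ℕ} (hi : 1 ≤ i) (hij : i ≤ j) (hjk : j ≤ k) :
    s.Ω j ⊆ s.Ω i := by
  obtain ⟨t, rfl⟩ : ∃ t, j = i + t := ⟨j - i, by omega⟩
  induction t with
  | zero => simp
  | succ t ih =>
    have h1 : s.Ω (i + t + 1) ⊆ s.Ω (i + t) := s.chain.Ω_succ_subset_Ω (by omega) (by omega)
    have h2 : s.Ω (i + (t + 1)) ⊆ s.Ω (i + t) := by rw [← Nat.add_assoc]; exact h1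
    exact h2.trans (ih (by omega) (by omega))

/-- ★★ **THE CUBE TOWER OF A MEETING DATUM LIES IN THE RECORD BELOW THE TOP**: for a separated sequence with `11d + 2ρ + M + 3 + 2ρ ≤ M₁`, a level-`n` datum (`2 ≤ n ≤ k`) whose print box
`box L (cornerP M ρ a) (sideP M ρ) n` has a point within `3` of a lift of a site of `Ω_n`, and every `1 ≤ i < n`: each fine point of the cube `□_i` of the (1.131) tower projects into `Ω_i`
(`□_i ⊆ □̃`, [6] p. 98; the `2ρ`-margin collar of 57a; `Ω_{n−1} ⊆ Ω_i`). [cite: Balaban1985Variational, (144) p.300, (150) p.301; Balaban1985RegularSpaces, p.98, (1.3)–(1.6) p.77; Balaban1988Convergent, (2.13) p.256] -/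
theorem cover_mem_Ω_of_mem_cube_of_meet {D : ℕ → Set (Set (Site P 0))} {k M₁ : ℕ} (hM₁ : 1 ≤ M₁) (s : Seq D k)
    (hsep : Sect2.SeqSeparated M₁ s) {ρ M : ℕ} (hρ : 1 ≤ ρ) (hfloor : 11 * P.d + 2 * ρ + M + 3 + 2 * ρ ≤ M₁) {n : ℕ} (hn : 2 ≤ n) (hnk : n ≤ k)
    {a x y : Pt P.d} (hx : x ∈ box P.L (cornerP P M ρ a) (sideP P M ρ) n) (hy : cover P y ∈ s.Ω n) (hxy : Within ((3 : ℕ) : ℤ) x y)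
    {i : ℕ} (hi1 : 1 ≤ i) (hin : i < n) {z : Pt P.d} (hz : z ∈ cube P.L (cornerP P M ρ a) (sideP P M ρ) ρ n i) :
    cover P z ∈ s.Ω i := by
  have hL2 : 2 ≤ P.L := by have := P.hL.2; omega
  have hL1 : 1 ≤ P.L := by omega
  have hS1 : 1 ≤ sideP P M ρ := by have := le_sideP (P := P) M hρ; omega
  -- `□_i ⊆ □̃`, and a point of `□̃` is within `2ρ·Lⁿ` of the print box
  have hz' : z ∈ tcube P.L (cornerP P M ρ a) (sideP P M ρ) ρ n := cube_subset_tcube hL2 hρ hin.le hz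
  obtain ⟨y', hy', hzy'⟩ := exists_mem_box_within_of_mem_tcube_of_corner (d := P.d) hL1 (a := cornerP P M ρ a) (a' := cornerP P M ρ a)
    (M := sideP P M ρ) (M' := sideP P M ρ) (ρ := ρ) (D := 2 * ρ) hS1 (fun i => by push_cast; linarith) (fun i => by push_cast; linarith) n hz'
  -- 57a's collar at margin `E = 2ρ`: `π z ∈ Ω_{n−1}`
  have h1 : cover P z ∈ s.Ω (n - 1) :=
    Sect2.cover_mem_Ω_pred_of_near_box_propCubeP_box hM₁ s hsep (Dw := 3) (E := 2 * ρ) hfloor hn hnk hx hy hxy hy' hzy'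
  exact Ω_anti_of_seq s hi1 (by omega) (by omega) h1

/-! ## §2  `hbelow` for the meet: the levelwise meet contains the cube tower strictly below the top -/

/-- ★★ **THE MEET `□ ⊓ D_rec` CONTAINS THE CUBE TOWER STRICTLY BELOW THE TOP** (the premise `hbelow` of k0-s1-w3's `K0S5CollarMeetFamily.level_succ_eq_of_near_below ∕ near_cases` at print's
(150) family): under §1's hypotheses and `n ≤ m + K`, `(cubeDomains …).Om i ⊆ (cubeDomains ⊓ domainsOfSeq Ω n).Om i` for `1 ≤ i < n` — a label of `□_i^{(i)}` has its whole `L^i`-block in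
`□_i ⊆ □_{i′}` (`i′ ≤ i`), hence in `Ω_{i′}` by §1. [cite: Balaban1985Variational, (150) p.301; Balaban1984PropagatorsII, (2.1)–(2.3) p.224; Balaban1985RegularSpaces, (1.131) p.99] -/
theorem cubeDomains_Om_subset_meet_Om {D : ℕ → Set (Set (Site P 0))} {k M₁ : ℕ} (hM₁ : 1 ≤ M₁) (s : Seq D k)
    (hsep : Sect2.SeqSeparated M₁ s) {ρ M : ℕ} (hρ : 1 ≤ ρ) (hfloor : 11 * P.d + 2 * ρ + M + 3 + 2 * ρ ≤ M₁) {n : ℕ} (hn : 2 ≤ n) (hnk : n ≤ k) (hnP : n ≤ P.m + P.K)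
    {a x y : Pt P.d} (hx : x ∈ box P.L (cornerP P M ρ a) (sideP P M ρ) n) (hy : cover P y ∈ s.Ω n) (hxy : Within ((3 : ℕ) : ℤ) x y) :
    ∀ i, 1 ≤ i → i < n → (cubeDomains P (cornerP P M ρ a) (sideP P M ρ) ρ n hnP).Om i ⊆
      (domainsMeet (cubeDomains P (cornerP P M ρ a) (sideP P M ρ) ρ n hnP) (domainsOfSeq s.Ω n hnP)).Om i := by
  intro i hi1 hin w hw
  rw [domainsMeet_Om, Finset.mem_inter]
  refine ⟨hw, ?_⟩
  rw [mem_domainsOfSeq_Om_iff _ hnP hin.le]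
  intro x' hx' i' hi'1 hi'i
  -- `w = π_i t` with `t` a label of `□_i^{(i)}`; `x'` is covered by the `L^i`-block of `t`, which lies in `□_i ⊆ □_{i'}`
  obtain ⟨t, ht, htw⟩ := (mem_cubeDomains_Om_iff hi1 hin.le _).1 hw
  have hmem : x' ∈ iterBlock i (coverAt P i t) := (mem_iterBlock i _ x').2 (hx'.trans htw.symm)
  rw [← image_cover_blockSites (hin.le.trans hnP) t, Finset.mem_image] at hmem
  obtain ⟨z, hz, rfl⟩ := hmem
  have hzi : z ∈ cube P.L (cornerP P M ρ a) (sideP P M ρ) ρ n i := blockSites_subset_cube_of_inBox ht (Finset.mem_coe.2 hz)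
  have hzi' : z ∈ cube P.L (cornerP P M ρ a) (sideP P M ρ) ρ n i' := cube_anti hi'i hin.le hzi
  exact cover_mem_Ω_of_mem_cube_of_meet hM₁ s hsep hρ hfloor hn hnk hx hy hxy hi'1 (by omega) hzi'

/-- ★ … so the meet's regions ARE the cubes strictly below the top: `(□ ⊓ D_rec).Om i = □_i^{(i)}` for `1 ≤ i < n` — print's (150) «`Ω′_j = □_j`, `j < k`».
[cite: Balaban1985Variational, (150) p.301] -/
theorem meet_Om_eq_cubeDomains_Om {D : ℕ → Set (Set (Site P 0))} {k M₁ : ℕ} (hM₁ : 1 ≤ M₁) (s : Seq D k)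
    (hsep : Sect2.SeqSeparated M₁ s) {ρ M : ℕ} (hρ : 1 ≤ ρ) (hfloor : 11 * P.d + 2 * ρ + M + 3 + 2 * ρ ≤ M₁) {n : ℕ} (hn : 2 ≤ n) (hnk : n ≤ k) (hnP : n ≤ P.m + P.K)
    {a x y : Pt P.d} (hx : x ∈ box P.L (cornerP P M ρ a) (sideP P M ρ) n) (hy : cover P y ∈ s.Ω n) (hxy : Within ((3 : ℕ) : ℤ) x y)
    {i : ℕ} (hi1 : 1 ≤ i) (hin : i < n) :
    (domainsMeet (cubeDomains P (cornerP P M ρ a) (sideP P M ρ) ρ n hnP) (domainsOfSeq s.Ω n hnP)).Om i =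
      (cubeDomains P (cornerP P M ρ a) (sideP P M ρ) ρ n hnP).Om i :=
  Finset.Subset.antisymm (domainsMeet_le_left _ _ i) (cubeDomains_Om_subset_meet_Om hM₁ s hsep hρ hfloor hn hnk hnP hx hy hxy i hi1 hin)

/-! ## §3  The near class of HCHART-MEET-NORM-77 at the meet: top cells, or level-(n−1) dent pairs -/

/-- ★★★ **THE THREE CASES OF A CELL OF PRINT's (150) FAMILY, FOR MODULE 77's NEAR CLASS** «top, or BOTH end blocks in the next cube»: under §1's hypotheses a cell `c` of
`D″ = cubeDomains ⊓ domainsOfSeq Ω n` is at the TOP level `n`; or it is a level-(n−1) DENT PAIR — `j(c) + 1 = n`, both end blocks in `□_{j(c)+1}^{(j(c)+1)}` (the top cube) and NEITHER in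
`(domainsOfSeq Ω n).Om (j(c)+1)` (print's `□′_n^{(n−1)}`: blocks of `□_n ∖ Ω_n`; the cells MODULE 75 serves); or it lies OUTSIDE the near class (then `ρ`-far from the print box, MODULE 77a
`hcollar_of_not_nearBoth`).  (At `n = 1` there is nothing below the top: the second case reads `j(c) = 0`.) [cite: Balaban1985Variational, (147)–(150) p.301, (160) p.303; Balaban1984PropagatorsII, (2.3) p.224] -/
theorem near_cases_meet_both {D : ℕ → Set (Set (Site P 0))} {k M₁ : ℕ} (hM₁ : 1 ≤ M₁) (s : Seq D k)
    (hsep : Sect2.SeqSeparated M₁ s) {ρ M : ℕ} (hρ : 1 ≤ ρ) (hfloor : 11 * P.d + 2 * ρ + M + 3 + 2 * ρ ≤ M₁) {n : ℕ} (hn1 : 1 ≤ n) (hnk : n ≤ k) (hnP : n ≤ P.m + P.K)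
    {a x y : Pt P.d} (hx : x ∈ box P.L (cornerP P M ρ a) (sideP P M ρ) n) (hy : cover P y ∈ s.Ω n) (hxy : Within ((3 : ℕ) : ℤ) x y)
    (c : BondIdx (domainsMeet (cubeDomains P (cornerP P M ρ a) (sideP P M ρ) ρ n hnP) (domainsOfSeq s.Ω n hnP))) :
    (c.1.1 : ℕ) = n ∨
    ((c.1.1 : ℕ) + 1 = n ∧
      blockOf c.1.2.src ∈ (cubeDomains P (cornerP P M ρ a) (sideP P M ρ) ρ n hnP).Om ((c.1.1 : ℕ) + 1) ∧
      blockOf c.1.2.tgt ∈ (cubeDomains P (cornerP P M ρ a) (sideP P M ρ) ρ n hnP).Om ((c.1.1 : ℕ) + 1) ∧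
      blockOf c.1.2.src ∉ (domainsOfSeq s.Ω n hnP).Om ((c.1.1 : ℕ) + 1) ∧
      blockOf c.1.2.tgt ∉ (domainsOfSeq s.Ω n hnP).Om ((c.1.1 : ℕ) + 1)) ∨
    ¬ ((c.1.1 : ℕ) = n ∨ (blockOf c.1.2.src ∈ (cubeDomains P (cornerP P M ρ a) (sideP P M ρ) ρ n hnP).Om ((c.1.1 : ℕ) + 1) ∧
          blockOf c.1.2.tgt ∈ (cubeDomains P (cornerP P M ρ a) (sideP P M ρ) ρ n hnP).Om ((c.1.1 : ℕ) + 1))) := by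
  have hDk : (domainsMeet (cubeDomains P (cornerP P M ρ a) (sideP P M ρ) ρ n hnP) (domainsOfSeq s.Ω n hnP)).k = n := by
    simp [domainsMeet_k, cubeDomains_k, domainsOfSeq_k]
  have hle : (c.1.1 : ℕ) ≤ n := by have := c.1.1.isLt; omega
  rcases eq_or_lt_of_le hle with htop | hlt
  · exact Or.inl htop
  by_cases hboth : blockOf c.1.2.src ∈ (cubeDomains P (cornerP P M ρ a) (sideP P M ρ) ρ n hnP).Om ((c.1.1 : ℕ) + 1) ∧
      blockOf c.1.2.tgt ∈ (cubeDomains P (cornerP P M ρ a) (sideP P M ρ) ρ n hnP).Om ((c.1.1 : ℕ) + 1)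
  · -- a near cell below the top: its level is `n − 1` (nothing to prove at `n = 1`; else `hbelow` + k0-s1-w3), and neither end block is in the record's `Ω_n^{(n)}` (`¬ Deep`)
    right; left
    have hlev : (c.1.1 : ℕ) + 1 = n := by
      rcases Nat.lt_or_ge n 2 with hn2 | hn2
      · omega
      · exact level_succ_eq_of_near_below (cubeDomains_Om_subset_meet_Om hM₁ s hsep hρ hfloor hn2 hnk hnP hx hy hxy) c hlt hboth.1
    obtain ⟨-, hns, hnt⟩ := c.2
    refine ⟨hlev, hboth.1, hboth.2, fun hs => hns ?_, fun ht => hnt ?_⟩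
    · show blockOf c.1.2.src ∈ (domainsMeet _ _).Om ((c.1.1 : ℕ) + 1)
      rw [domainsMeet_Om, Finset.mem_inter]
      exact ⟨hboth.1, hs⟩
    · show blockOf c.1.2.tgt ∈ (domainsMeet _ _).Om ((c.1.1 : ℕ) + 1)
      rw [domainsMeet_Om, Finset.mem_inter]
      exact ⟨hboth.2, ht⟩
  · exact Or.inr (Or.inr (not_or.mpr ⟨hlt.ne, hboth⟩))

end Summit.QuantumFields.YangMills.BalabanUVNodes.N07CubeTowerInsideRecordBelowTop

end
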